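import Mathlib
import Summits.Ventures.HodgeRepro.PeriodCloserC7Model
import Summits.Ventures.HodgeRepro.PeriodCloserC7LineClasses

/-!
# PeriodCloserC7LineClassesModel — non-vacuity of the refined hypothesis set `ChainHypothesesFree`

Blind re-derivation cell `pub-hodge-repro`, seat night-2 (gen 3).  Target tree path
`lean/Summits/Ventures/HodgeRepro/PeriodCloserC7LineClassesModel.lean`.  Does for `PeriodCloserC7LineClasses.lean` what gen
0's `PeriodCloserC7Model.lean` does for the chain: exhibits an instantiation of the interface, with reciprocity data and a
line-class interface, satisfying every hypothesis of `S4face_of_chain_free` — so the hypothesis set with the (E2) clause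
discharged is not self-contradictory.

**The toy** (`toyFace2`): two places `Bool` (`false` split, `true` non-split), characters = signs `ℤˣ`, the global root
number the sign, the local root number the sign at `true` and `1` at `false` (so Tate's product formula holds), data =
pairs (character signs, line classes) with admissible = even character signs, TP1's local condition at `v` = «the classes
of the two lines of the torus equal their local root numbers at `v`», toric periods non-zero exactly when TP1's condition
holds (so TP1's theorem holds by definition), everything else as in gen 0's toy.  Reciprocity data `toyNRD`: global classes
= signs with the same local symbol at both places (product `1`; a pair with product `1` is a pair of equal signs).
Line-class interface `toyC`: the classes are the second component of the datum, re-equipping replaces it, and TP1's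
condition IS the norm-residue equation by construction.

WHAT THIS IS NOT: a toy, with no automorphic content; it shows consistency of the hypothesis set, nothing about the face.
Nothing here says anything about the status of the Hodge conjecture for CM abelian varieties, which is NOT proved.
-/

set_option autoImplicit false

noncomputable section

namespace Summit.Ventures.HodgeRepro.PeriodCloser

open NumberField

variable (L : Type) [Field L] [NumberField L] [IsCMField L]

/-- **The two-place toy face**: as gen 0's `toyFace`, with places `Bool` (`false` split, `true` not), data = (sign
vector of the characters, sign vector of the line classes), the local root number the sign at `true` and `1` at `false`,
and TP1's condition at `v` = «the classes of the two lines of the torus equal their local root numbers at `v`». -/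
abbrev toyFace2 : C7Face L where
  Place := Bool
  IsSplit := fun v => v = false
  IsUnramified := fun _ => True
  HeckeChar := ℤˣ
  IsSelfDual := fun _ => True
  rootNumber := id
  localRootNumber := fun v χ => if v then χ else 1
  centralValue := fun _ => 1
  Xi := fun _ => ℕ
  twist := fun _ χ _ => χ
  flip := fun χ => -χ
  seesaw := toySeesaw L
  S4face := True
  WeilPeriodWitness := True
  Datum := (Fin 4 → ℤˣ) × (Fin 4 → ℤˣ)
  Admissible := fun d => d.1 0 * d.1 1 = d.1 2 * d.1 3
  chars := Prod.fst
  hodgePairing := fun _ => 1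
  torusPeriod := fun _ => 1
  Tau := Unit
  U1Char := Unit
  thetaLift := fun _ => ()
  betaOf := fun _ => ()
  toricPeriodNonzero := fun i d _ => ∀ v : Bool, ∀ k : Fin 2, d.2 (line i k) = (if v then d.1 (line i k) else 1)
  liftNonzero := fun _ => True
  Compat := fun _ _ => True
  LocalRootCond := fun i v d => ∀ k : Fin 2, d.2 (line i k) = (if v then d.1 (line i k) else 1)

/-- **Toy reciprocity data**: global classes = signs, the same local symbol at both places (so the product is `1`, and
a pair of equal signs is the only pair with product `1`). -/
def toyNRD : NormResidueData Bool where
  Global := ℤˣ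
  omega := fun a _ => a
  finite := fun _ => Set.toFinite _
  product_one := fun a => by
    rw [finprod_eq_prod_of_fintype, Fintype.prod_bool]
    exact Int.units_mul_self a
  exists_of_product_one := fun c _ hc => by
    rw [finprod_eq_prod_of_fintype, Fintype.prod_bool] at hc
    refine ⟨c true, fun v => ?_⟩
    rcases Int.units_eq_one_or (c true) with h1 | h1 <;> rcases Int.units_eq_one_or (c false) with h2 | h2 <;>
      cases v <;> simp_all

/-- **The toy line-class interface**: the classes are the second component, re-equipping replaces it, TP1's condition
is the norm-residue equation by construction. -/
def toyC : LineClassInterface (toyFace2 L) toyNRD where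
  lineClass := Prod.snd
  withClasses := fun d a => (d.1, a)
  lineClass_withClasses := fun _ _ => rfl
  chars_withClasses := fun _ _ => rfl
  betaOf_withClasses := fun _ _ => rfl
  compat_withClasses := fun _ _ _ => Iff.rfl
  admissible_withClasses := fun _ _ hd => hd
  localRootCond_iff := fun _ _ _ => Iff.rfl

/-- The toy satisfies Tate's product formula (two places: the sign at `true`, `1` at `false`). -/
theorem toy2_productFormula : ProductFormula (toyFace2 L) :=
  ⟨fun _ => Set.toFinite _, fun χ => by
    show χ = ∏ᶠ v : Bool, (if v then χ else 1)
    rw [finprod_eq_prod_of_fintype, Fintype.prod_bool]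
    simp⟩

/-- The toy satisfies the identification. -/
theorem toy2_identification : Identification (toyFace2 L) :=
  ⟨fun _ => rfl, ⟨fun _ => ⟨(fun _ => 1, fun _ => 1), (), fun _ v _ => by cases v <;> rfl, trivial⟩,
    fun _ => ⟨(fun _ => 1, fun _ => 1), one_ne_zero⟩⟩⟩

/-- Flipping an N2-compatible pattern of an even sign vector gives an even sign vector (gen 0's `toy_flip_even`,
for the two-place toy). -/
theorem toy2_flip_even (d : Fin 4 → ℤˣ) (J : Fin 4 → Bool) (hd : d 0 * d 1 = d 2 * d 3) (hJ : N2compat J) :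
    flipOn (toyFace2 L) d J 0 * flipOn (toyFace2 L) d J 1 =
      flipOn (toyFace2 L) d J 2 * flipOn (toyFace2 L) d J 3 := by
  unfold N2compat at hJ
  simp only [flipOn]
  revert hJ
  cases h0 : J 0 <;> cases h1 : J 1 <;> cases h2 : J 2 <;> cases h3 : J 3 <;> intro hJ <;>
    simp at hJ <;> simp [hd]

/-- The toy admissible family. -/
theorem toy2_family : AdmissibleFamily (toyFace2 L) where
  base := ⟨(fun _ => 1, fun _ => 1), rfl⟩
  selfDual := fun _ _ _ => trivial
  flip_mem := fun d J hd hJ => ⟨(flipOn (toyFace2 L) d.1 J, d.2), toy2_flip_even L d.1 J hd hJ, rfl⟩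
  split := ⟨false, rfl⟩
  twist_mem := fun d _ _ hd _ => ⟨d, hd, rfl⟩

/-- (E3) on the toy: at `true` it is the evenness of the character signs, at `false` it is `1 · 1 = 1 · 1`. -/
theorem toy2_e3 (d : (toyFace2 L).Datum) (hd : (toyFace2 L).Admissible d) : (toyFace2 L).E3 d := by
  intro v
  cases v
  · rfl
  · exact hd

/-- **The free hypothesis set is satisfiable on the toy.** -/
theorem toy2_chainHypothesesFree : ChainHypothesesFree (toyC L) where
  ident := toy2_identification L
  lemmaPi := Iff.rfl
  witness := fun _ => trivial
  tp1 := fun _ _ => ⟨fun h => ⟨trivial, fun _ => h _, mul_ne_zero one_ne_zero one_ne_zero⟩, fun h => h.2.1⟩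
  bhty := fun _ _ _ _ => by
    refine Set.Finite.subset (Set.finite_empty) fun ν hν => ?_
    exact absurd hν.2 one_ne_zero
  bhtySplit := fun _ _ _ _ => by
    refine Set.Finite.subset (Set.finite_empty) fun ν hν => ?_
    exact hν rfl
  xi := ⟨fun _ => inferInstanceAs (Infinite ℕ), fun _ _ => trivial⟩
  productFormula := toy2_productFormula L
  flipAdm := fun _ _ _ => rfl
  dischargeFree := ⟨fun _ _ _ => trivial, toy2_e3 L, fun _ _ => trivial⟩
  family := toy2_family L

/-- **Non-vacuity of `S4face_of_chain_free`**: an interface, reciprocity data and a line-class interface satisfying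
`ChainHypothesesFree` exist for every CM field `L`. -/
theorem chainHypothesesFree_satisfiable :
    ∃ (I : C7Face L) (D : NormResidueData I.Place) (C : LineClassInterface I D), ChainHypothesesFree C :=
  ⟨toyFace2 L, toyNRD, toyC L, toy2_chainHypothesesFree L⟩

/-- The free closer applied to the toy returns its (trivial) conclusion. -/
theorem toy2_S4face : (toyFace2 L).S4face :=
  S4face_of_chain_free (toyC L) (toy2_chainHypothesesFree L)

end Summit.Ventures.HodgeRepro.PeriodCloser

end
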